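import Literature.AnabelianGeometry.AbsoluteAnabelian.MLFGaloisElasticProofs
import Literature.AnabelianGeometry.AbsoluteAnabelian.AbsTopIGraphTheoreticitySchemata
import HarnessLib

/-!
# The elasticity DICHOTOMY for `Δ ⊆ Π` under isomorphisms of extensions with MLF base
# ([AbsTopI] Thm 1.7 (ii) / Thm 2.6 (iv)–(v): the case `Σ = 𝔓𝔯𝔦𝔪𝔢𝔰` isolated; proof-only)

S. Mochizuki, *Topics in Absolute Anabelian Geometry I: Generalities*, J. Math. Sci. Univ. Tokyo **19**
(2012) [AbsTopI], Thm 1.7 (ii) p. 14 ("If `k` is an MLF of residue characteristic `p`, then `G_k` [...] is elastic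
and slim"), Thm 2.6 (iv)/(v)
p. 22 and its proof p. 24 ("the image of `N` in `G` is a topologically finitely generated closed normal
subgroup, so by elasticity it is trivial or of finite index") [cite: MochizukiAbsTopI2012, Thm 2.6 (iv) p.22];
[AbsAnab] Lemma 1.3.8 p. 18 (Group-Theoreticity of Arithmetic Quotients: "The isomorphism `α_X` is necessarily
compatible with the quotients `Π_{(X_i)_{K_i}} ↠ G_{K_i}`"; summarised below as «`Δ ⊆ Π` is group-theoretic», which is
NOT print's wording) [cite: MochizukiAbsAnab2004, Lemma 1.3.8 p.18].

Cell `abc-iut`, seat abc-iut-w6-d055 (gen 5), layer L4 vocabulary (`FundamentalExtension`, `MLFBase`,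
`PreservesGeom`, `IsElastic`, `freeProlRank`), written for the (H1) «`Δ ⊆ Π` characteristic» binders that the
K-L6 chain keeps BY NAME at the genuine [EtTh] models (abc-iut-L2-lead R565 «HDELTAX-MODELTATE-REDUCTION»,
abc-iut-f-142 18:11:29Z desk reduction, abc-iut-w5-d233 `ThetaSettingCompletionPackage`: there (H1) is reduced
to FACT-LIST F-0001 at a named completion package).  PROOF-ONLY: no definition, no named fact, nothing restated.

WHAT IS PROVED (for ANY extensions `E`, `F` with MLF base data and an isomorphism of topological groups
`φ : Π_E ⥲ Π_F`; the only inputs are the tree's theorems `MLFBase.isElastic_gal` — elasticity of `G_k`,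
[AbsTopI] Thm 1.7 (ii), proved in `MLFGaloisElasticProofs` — and the rank formula `thm26_ii_delta_gal_holds`):

* `MLFBase.map_geom_le_geom_or_isOpen` — if `Δ_E` is topologically finitely generated, then EITHER
  `φ(Δ_E) ⊆ Δ_F` OR the image of `φ(Δ_E)` in `G_F` is an OPEN (normal) subgroup.  (Printed step of the proof
  of Thm 2.6 (iv), p. 24, without the almost-pro-omissivity that the tree's `le_geom_of_isAlmostProOmissive…`
  needs to exclude the second alternative.)
* `MLFBase.preservesGeom_of_map_geom_le` — the ONE-SIDED inclusion `φ(Δ_E) ⊆ Δ_F` already forces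
  `φ(Δ_E) = Δ_F` (`Δ_F` tfg): the mixed case "`φ⁻¹(Δ_F)` has open image in `G_E`" would make `Δ_F` of finite
  index in `Π_F`, i.e. `G_F ≅ G_k` FINITE — absurd (`MLFBase.not_isAlmostProOmissive_of_isOpen` at `⊥`).
* `MLFBase.preservesGeom_or_isOpen` — THE DICHOTOMY: `PreservesGeom φ`, OR BOTH images
  `aug_F(φ(Δ_E)) ⊆ G_F` and `aug_E(φ⁻¹(Δ_F)) ⊆ G_E` are open.  So for `Σ = 𝔓𝔯𝔦𝔪𝔢𝔰` (where Thm 2.6 (iv) is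
  silent and Thm 2.6 (v) needs condition (∗) / F-0001) the WHOLE residual content of «`Δ ⊆ Π` is
  characteristic» is the exclusion of the doubly-open case.
* `MLFBase.map_geom_inf_geom_ne_bot_of_isOpen` — in the open case the "exotic" image meets `Δ_F`
  non-trivially, `φ(Δ_E) ∩ Δ_F ≠ 1`, as soon as `Δ_E` is `δ¹`-BALANCED at one prime `ℓ ≠ p`
  (`δ¹_ℓ(Δ_E) = δ¹_p(Δ_E)`, e.g. `Δ_E` free profinite of finite rank): otherwise `Δ_E ≅ φ(Δ_E)` would be
  isomorphic to an open subgroup `G_{k′}` of `G_k`, whose ranks `δ¹_ℓ = 1 < [k′:ℚ_p] + 1 = δ¹_p` are unbalanced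
  (`thm26_ii_delta_gal_holds`).

HONEST SCOPE: classical group theory over the tree's typed [AbsTopI] predicates; it does NOT decide (H1) at any
model (the doubly-open case with `φ(Δ_E) ∩ Δ_F ≠ 1` is exactly what condition (∗) / F-0001 excludes in print);
nothing here bears on [IUTchIII] Cor. 3.12; no side is taken; typed ≠ proved elsewhere.
-/

noncomputable section

open Topology Field

namespace Literature.AnabelianGeometry.AbsoluteAnabelian

namespace FundamentalExtension

variable {E F : FundamentalExtension.{0}}

/-! ### Step of the printed proof of Thm 2.6 (iv): the image of `φ(Δ_E)` in `G_F` is trivial or open -/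

/-- **Elasticity step** ([AbsTopI] proof of Thm 2.6 (iv), p. 24): for an extension `F` with MLF base data and
ANY extension `E` with `Δ_E` topologically finitely generated, an isomorphism of topological groups
`φ : Π_E ⥲ Π_F` either carries `Δ_E` INTO `Δ_F`, or the image of `φ(Δ_E)` in `G_F` — a topologically finitely
generated closed normal subgroup, hence (elasticity of `G_k`, Thm 1.7 (ii)) trivial or of finite index — is
an OPEN subgroup of `G_F`. [cite: MochizukiAbsTopI2012, Thm 2.6 (iv) p.22] -/
theorem MLFBase.map_geom_le_geom_or_isOpen (BF : F.MLFBase) (hΔE : IsTopologicallyFinitelyGenerated E.geom)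
    (φ : E.arith ≃ₜ* F.arith) :
    E.geom.map φ.toMulEquiv.toMonoidHom ≤ F.geom ∨
      IsOpen (((E.geom.map φ.toMulEquiv.toMonoidHom).map F.aug.toMonoidHom : Subgroup F.gal) : Set F.gal) := by
  set N : Subgroup F.arith := E.geom.map φ.toMulEquiv.toMonoidHom with hNdef
  -- `N = φ(Δ_E)` is a topologically finitely generated closed normal subgroup of `Π_F`
  let f : E.arith →ₜ* F.arith := ⟨φ.toMulEquiv.toMonoidHom, φ.continuous⟩
  let ψ : E.geom →ₜ* N :=
    ⟨f.toMonoidHom.subgroupMap E.geom,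
      Continuous.subtype_mk ((map_continuous f).comp continuous_subtype_val) _⟩
  have hψ : Function.Surjective ψ := f.toMonoidHom.subgroupMap_surjective E.geom
  have hNn : N.Normal := E.normal_geom.map φ.toMulEquiv.toMonoidHom φ.surjective
  have hNc : IsClosed (N : Set F.arith) := by
    have : (N : Set F.arith) = φ '' (E.geom : Set E.arith) := by
      rw [hNdef, Subgroup.coe_map]
      rfl
    rw [this]
    exact φ.toHomeomorph.isClosedMap _ E.isClosed_geom
  have hNfg : IsTopologicallyFinitelyGenerated N := hΔE.of_surjective ψ hψ
  -- its image `M` in `G_F`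
  set M : Subgroup F.gal := N.map F.aug.toMonoidHom with hMdef
  let g : N →ₜ* M :=
    ⟨F.aug.toMonoidHom.subgroupMap N,
      Continuous.subtype_mk ((map_continuous F.aug).comp continuous_subtype_val) _⟩
  have hg : Function.Surjective g := F.aug.toMonoidHom.subgroupMap_surjective N
  have hMn : M.Normal := hNn.map F.aug.toMonoidHom F.aug_surjective
  have hMc : IsClosed (M : Set F.gal) := by
    rw [hMdef, Subgroup.coe_map]
    exact (hNc.isCompact.image (map_continuous F.aug)).isClosed
  have hMfg : IsTopologicallyFinitelyGenerated M := hNfg.of_surjective g hg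
  -- elasticity of `G_F`, applied with the open subgroup `H = G_F` itself
  have htop : IsOpen (((⊤ : Subgroup F.gal)) : Set F.gal) := by
    rw [Subgroup.coe_top]
    exact isOpen_univ
  have hMn' : (M.subgroupOf ⊤).Normal := by
    refine (Subgroup.normal_subgroupOf_iff_le_normalizer le_top).mpr ?_
    rw [Subgroup.normalizer_eq_top M]
  rcases (MLFBase.isElastic_gal BF).eq_bot_or_finiteIndex ⊤ M htop le_top hMn' hMc hMfg with hbot | hfin
  · -- `M = 1`: `φ(Δ_E) ⊆ Ker(aug_F) = Δ_F`
    left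
    intro y hy
    rw [mem_geom]
    have hyM : F.aug y ∈ M := ⟨y, hy, rfl⟩
    rw [hbot] at hyM
    exact Subgroup.mem_bot.mp hyM
  · -- `M` closed of finite index, hence open
    right
    haveI := hfin
    exact Subgroup.isOpen_of_isClosed_of_finiteIndex M hMc

/-! ### The mixed case is absurd: a one-sided inclusion already gives `PreservesGeom` -/

/-- A trivial group is almost pro-omissive (it is pro-`Σ` for every `Σ`: all indices are `1`).
[cite: MochizukiAbsTopI2012, Def 1.1 (iii) p.10] -/
private theorem isAlmostProOmissive_of_subsingleton {G : Type*} [Group G] [TopologicalSpace G]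
    [Subsingleton G] : IsAlmostProOmissive G := by
  refine ⟨2, ⊤, Nat.prime_two, ?_, ⟨fun U _ _ q hq hdvd => ?_⟩⟩
  · rw [Subgroup.coe_top]
    exact isOpen_univ
  · exfalso
    have hU : U = ⊤ := by
      ext x
      simp only [Subgroup.mem_top, iff_true]
      rw [Subsingleton.elim x 1]
      exact U.one_mem
    rw [hU, Subgroup.index_top] at hdvd
    exact hq.one_lt.ne' (Nat.dvd_one.mp hdvd)

/-- **One-sided inclusion suffices**: for extensions `E`, `F` with MLF base data and `Δ_F` topologically
finitely generated, if an isomorphism `φ : Π_E ⥲ Π_F` carries `Δ_E` INTO `Δ_F`, then it carries `Δ_E` ONTO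
`Δ_F` (`PreservesGeom φ`).  Proof: apply the elasticity step to `φ⁻¹`; the alternative "the image of
`φ⁻¹(Δ_F) ⊇ Δ_E` in `G_E` is open" would give `[Π_F : Δ_F] < ∞`, i.e. the trivial subgroup of `G_F ≅ G_k` open —
excluded since no open subgroup of `G_k` is almost pro-omissive (`MLFBase.not_isAlmostProOmissive_of_isOpen`).
[cite: MochizukiAbsTopI2012, Thm 2.6 (iv) p.22] -/
theorem MLFBase.preservesGeom_of_map_geom_le (BE : E.MLFBase) (BF : F.MLFBase)
    (hΔF : IsTopologicallyFinitelyGenerated F.geom) (φ : E.arith ≃ₜ* F.arith)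
    (hle : E.geom.map φ.toMulEquiv.toMonoidHom ≤ F.geom) : PreservesGeom φ := by
  rcases BE.map_geom_le_geom_or_isOpen hΔF φ.symm with hle' | hopen
  · -- both inclusions: equality
    refine le_antisymm hle ?_
    have h2 : (F.geom.map φ.symm.toMulEquiv.toMonoidHom).map φ.toMulEquiv.toMonoidHom = F.geom := by
      rw [Subgroup.map_map]
      have : φ.toMulEquiv.toMonoidHom.comp φ.symm.toMulEquiv.toMonoidHom = MonoidHom.id _ := by
        ext x
        exact φ.apply_symm_apply x
      rw [this, Subgroup.map_id]
    calc F.geom = (F.geom.map φ.symm.toMulEquiv.toMonoidHom).map φ.toMulEquiv.toMonoidHom := h2.symm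
      _ ≤ E.geom.map φ.toMulEquiv.toMonoidHom := Subgroup.map_mono hle'
  · -- the mixed case: `N' := φ⁻¹(Δ_F) ⊇ Δ_E` with open image `M'` in `G_E`
    exfalso
    set N' : Subgroup E.arith := F.geom.map φ.symm.toMulEquiv.toMonoidHom with hN'def
    set M' : Subgroup E.gal := N'.map E.aug.toMonoidHom with hM'def
    have hEN' : E.geom ≤ N' := by
      intro x hx
      have hφx : φ x ∈ F.geom := hle ⟨x, hx, rfl⟩
      exact ⟨φ x, hφx, φ.symm_apply_apply x⟩
    -- `N' = aug_E⁻¹(M')` since `N' ⊇ Δ_E = Ker(aug_E)`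
    have hN'eq : N' = M'.comap E.aug.toMonoidHom := by
      refine le_antisymm (Subgroup.le_comap_map _ _) ?_
      intro x hx
      obtain ⟨y, hy, hyx⟩ := hx
      have hk : y⁻¹ * x ∈ E.geom := by
        rw [mem_geom, map_mul, map_inv]
        change (E.aug.toMonoidHom y)⁻¹ * E.aug.toMonoidHom x = 1
        rw [hyx, inv_mul_cancel]
      have hmem := N'.mul_mem hy (hEN' hk)
      rwa [mul_inv_cancel_left] at hmem
    -- `M'` open in the profinite `G_E`, hence of finite index; so `Δ_F = φ(N')` has finite index in `Π_F`
    haveI : Finite (E.gal ⧸ M') := Subgroup.quotient_finite_of_isOpen M' hopen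
    haveI hM'fin : M'.FiniteIndex := Subgroup.finiteIndex_of_finite_quotient
    have hidx : F.geom.index = M'.index := by
      have h1 : N'.index = F.geom.index := by
        rw [hN'def]
        exact Subgroup.index_map_of_bijective φ.symm.bijective F.geom
      rw [← h1, hN'eq]
      exact M'.index_comap_of_surjective E.aug_surjective
    haveI hFfin : F.geom.FiniteIndex := ⟨by rw [hidx]; exact hM'fin.index_ne_zero⟩
    -- hence the trivial subgroup of `G_F` is closed of finite index, i.e. open
    have hbot_idx : (⊥ : Subgroup F.gal).index = F.geom.index := by
      rw [← (⊥ : Subgroup F.gal).index_comap_of_surjective F.aug_surjective]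
      rfl
    haveI : (⊥ : Subgroup F.gal).FiniteIndex := ⟨by rw [hbot_idx]; exact hFfin.index_ne_zero⟩
    have hbot_closed : IsClosed (((⊥ : Subgroup F.gal)) : Set F.gal) := by
      rw [Subgroup.coe_bot]
      exact isClosed_singleton
    have hbot_open : IsOpen (((⊥ : Subgroup F.gal)) : Set F.gal) :=
      Subgroup.isOpen_of_isClosed_of_finiteIndex ⊥ hbot_closed
    -- but no open subgroup of `G_F ≅ G_k` is almost pro-omissive, while the trivial group is
    haveI : Subsingleton (⊥ : Subgroup F.gal) :=
      ⟨fun a b => Subtype.ext ((Subgroup.mem_bot.mp a.2).trans (Subgroup.mem_bot.mp b.2).symm)⟩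
    exact MLFBase.not_isAlmostProOmissive_of_isOpen BF ⊥ hbot_open isAlmostProOmissive_of_subsingleton

/-! ### The dichotomy -/

/-- **THE ELASTICITY DICHOTOMY** for «`Δ ⊆ Π` is characteristic» ([AbsTopI] Thm 2.6 (iv)/(v), case
`Σ = 𝔓𝔯𝔦𝔪𝔢𝔰` isolated): for extensions `E`, `F` with MLF base data and topologically finitely generated
`Δ_E`, `Δ_F`, an isomorphism of topological groups `φ : Π_E ⥲ Π_F` EITHER satisfies `PreservesGeom φ`
(`φ(Δ_E) = Δ_F`), OR BOTH the image of `φ(Δ_E)` in `G_F` and the image of `φ⁻¹(Δ_F)` in `G_E` are OPEN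
subgroups.  (Print excludes the second alternative by almost pro-omissivity when `Σ ≠ 𝔓𝔯𝔦𝔪𝔢𝔰`, Thm 2.6 (iv),
and by condition (∗) when `Σ = 𝔓𝔯𝔦𝔪𝔢𝔰`, Thm 2.6 (v).) [cite: MochizukiAbsTopI2012, Thm 2.6 (iv) p.22] -/
theorem MLFBase.preservesGeom_or_isOpen (BE : E.MLFBase) (BF : F.MLFBase)
    (hΔE : IsTopologicallyFinitelyGenerated E.geom) (hΔF : IsTopologicallyFinitelyGenerated F.geom)
    (φ : E.arith ≃ₜ* F.arith) :
    PreservesGeom φ ∨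
      (IsOpen (((E.geom.map φ.toMulEquiv.toMonoidHom).map F.aug.toMonoidHom : Subgroup F.gal) : Set F.gal) ∧
        IsOpen (((F.geom.map φ.symm.toMulEquiv.toMonoidHom).map E.aug.toMonoidHom : Subgroup E.gal) :
          Set E.gal)) := by
  rcases BF.map_geom_le_geom_or_isOpen hΔE φ with hle | hopen
  · exact Or.inl (MLFBase.preservesGeom_of_map_geom_le BE BF hΔF φ hle)
  rcases BE.map_geom_le_geom_or_isOpen hΔF φ.symm with hle' | hopen'
  · left
    have h : PreservesGeom φ.symm := MLFBase.preservesGeom_of_map_geom_le BF BE hΔE φ.symm hle'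
    -- `φ.symm.symm` is `φ`
    exact h.symm
  · exact Or.inr ⟨hopen, hopen'⟩

/-- COROLLARY (the form the K-L6 custody binders use): under the same hypotheses, if the image of `φ(Δ_E)`
in `G_F` is NOT open then `φ(Δ_E) = Δ_F`. [cite: MochizukiAbsTopI2012, Thm 2.6 (iv) p.22] -/
theorem MLFBase.preservesGeom_of_not_isOpen (BE : E.MLFBase) (BF : F.MLFBase)
    (hΔE : IsTopologicallyFinitelyGenerated E.geom) (hΔF : IsTopologicallyFinitelyGenerated F.geom)
    (φ : E.arith ≃ₜ* F.arith)
    (h : ¬ IsOpen (((E.geom.map φ.toMulEquiv.toMonoidHom).map F.aug.toMonoidHom : Subgroup F.gal) :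
      Set F.gal)) : PreservesGeom φ := by
  rcases MLFBase.preservesGeom_or_isOpen BE BF hΔE hΔF φ with hP | ⟨hopen, -⟩
  · exact hP
  · exact absurd hopen h

/-! ### In the open case the exotic image meets `Δ_F` (for `δ¹`-balanced `Δ_E`) -/

/-- The ranks of an open subgroup `M` of the Galois group `G_F ≅ G_k` of an extension with MLF base data:
`δ¹_q(M) = 1` for every prime `q ≠ p` and `δ¹_p(M) = [k : ℚ_p]·[G_k : M] + 1` (`M = G_{k′}`; [AbsTopI] Thm 2.6
(ii) via the landed `thm26_ii_delta_gal_holds` / `freeProlRank_eq_of_isOpen_absoluteGaloisGroup`, transported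
along `galIso`). [cite: MochizukiAbsTopI2012, Thm 2.6 (ii) p.21] -/
theorem MLFBase.freeProlRank_of_isOpen_gal (BF : F.MLFBase) (M : Subgroup F.gal) (hM : IsOpen (M : Set F.gal)) :
    (∀ (q : ℕ) [Fact q.Prime], q ≠ BF.p → freeProlRank M q = 1) ∧
      @freeProlRank M _ _ BF.p BF.instPrime =
        ((Module.finrank ℚ_[BF.p] BF.K * (M.map BF.galIso.toMulEquiv.toMonoidHom).index + 1 : ℕ) : ℕ∞) := by
  letI := BF.instPrime
  haveI : CharZero BF.K := charZero_of_injective_algebraMap (algebraMap ℚ_[BF.p] BF.K).injective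
  -- transport `M` to an open subgroup `U` of `G_k`
  set U : Subgroup (absoluteGaloisGroup BF.K) := M.map BF.galIso.toMulEquiv.toMonoidHom with hUdef
  have hUo : IsOpen (U : Set (absoluteGaloisGroup BF.K)) := by
    have h1 : (U : Set (absoluteGaloisGroup BF.K)) = BF.galIso '' (M : Set F.gal) := by
      rw [hUdef, Subgroup.coe_map]
      rfl
    rw [h1]
    exact BF.galIso.toHomeomorph.isOpenMap _ hM
  -- `M ≃ₜ* U` (a continuous bijective homomorphism from a compact group onto a Hausdorff one)
  haveI : CompactSpace M := isCompact_iff_compactSpace.mp (M.isClosed_of_isOpen hM).isCompact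
  let g : M →ₜ* U :=
    ⟨BF.galIso.toMulEquiv.toMonoidHom.subgroupMap M,
      Continuous.subtype_mk ((map_continuous BF.galIso).comp continuous_subtype_val) _⟩
  have hg : Function.Bijective g := by
    refine ⟨fun a b h => Subtype.ext (BF.galIso.injective (congrArg Subtype.val h)),
      BF.galIso.toMulEquiv.toMonoidHom.subgroupMap_surjective M⟩
  obtain ⟨e⟩ : Nonempty (M ≃ₜ* U) :=
    ⟨{ toMulEquiv := MulEquiv.ofBijective g.toMonoidHom hg
       continuous_toFun := g.continuous
       continuous_invFun :=
         (Continuous.homeoOfEquivCompactToT2 (f := Equiv.ofBijective g hg) g.continuous).symm.continuous }⟩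
  -- `U = G_{k′}` for a finite extension `k′/k`
  obtain ⟨L, hLfin, -, hLU⟩ := exists_intermediateField_of_isOpen_absoluteGaloisGroup BF.K U hUo
  haveI := hLfin
  haveI : FiniteDimensional ℚ_[BF.p] L := Module.Finite.trans BF.K L
  obtain ⟨eL⟩ := nonempty_continuousMulEquiv_fixingSubgroup BF.K L
  rw [hLU] at eL
  refine ⟨fun q _ hqp => ?_, ?_⟩
  · rw [freeProlRank_eq_of_continuousMulEquiv e q, freeProlRank_eq_of_continuousMulEquiv eL q]
    rw [(thm26_ii_delta_gal_holds BF.p L).1 q hqp]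
  · rw [freeProlRank_eq_of_continuousMulEquiv e BF.p]
    exact freeProlRank_eq_of_isOpen_absoluteGaloisGroup BF.p BF.K U hUo

/-- **In the open case the image of `Δ_E` MEETS `Δ_F`** when `Δ_E` is `δ¹`-balanced: for extensions `E`, `F`
with `F` of MLF base data `(p, k)`, if the image of `φ(Δ_E)` in `G_F` is open and `δ¹_ℓ(Δ_E) = δ¹_p(Δ_E)` for
some prime `ℓ ≠ p` (e.g. `Δ_E` a free profinite group of finite rank), then `φ(Δ_E) ∩ Δ_F ≠ 1`.  Indeed
`φ(Δ_E) ∩ Δ_F = 1` would make `aug_F : φ(Δ_E) ⥲ M` an isomorphism onto an open `M = G_{k′} ⊆ G_k`, whose ranks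
`δ¹_ℓ(G_{k′}) = 1 < [k′ : ℚ_p] + 1 = δ¹_p(G_{k′})` ([AbsTopI] Thm 2.6 (ii)) are NOT balanced. (So the residual
content of «`Δ ⊆ Π` characteristic» at `Σ = 𝔓𝔯𝔦𝔪𝔢𝔰` is the doubly-open case WITH non-trivial intersection —
the case print's condition (∗) of Thm 2.6 (v) excludes.) [cite: MochizukiAbsTopI2012, Thm 2.6 (v) p.22] -/
theorem MLFBase.map_geom_inf_geom_ne_bot_of_isOpen (BF : F.MLFBase) (φ : E.arith ≃ₜ* F.arith)
    (hopen : IsOpen (((E.geom.map φ.toMulEquiv.toMonoidHom).map F.aug.toMonoidHom : Subgroup F.gal) :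
      Set F.gal))
    {ℓ : ℕ} [Fact ℓ.Prime] (hℓ : ℓ ≠ BF.p)
    (hbal : freeProlRank E.geom ℓ = @freeProlRank E.geom _ _ BF.p BF.instPrime) :
    E.geom.map φ.toMulEquiv.toMonoidHom ⊓ F.geom ≠ ⊥ := by
  letI := BF.instPrime
  intro hinf
  set N : Subgroup F.arith := E.geom.map φ.toMulEquiv.toMonoidHom with hNdef
  set M : Subgroup F.gal := N.map F.aug.toMonoidHom with hMdef
  -- `N = φ(Δ_E)` is closed, hence compact
  have hNc : IsClosed (N : Set F.arith) := by
    have : (N : Set F.arith) = φ '' (E.geom : Set E.arith) := by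
      rw [hNdef, Subgroup.coe_map]
      rfl
    rw [this]
    exact φ.toHomeomorph.isClosedMap _ E.isClosed_geom
  haveI : CompactSpace N := isCompact_iff_compactSpace.mp hNc.isCompact
  haveI : CompactSpace E.geom := isCompact_iff_compactSpace.mp E.isClosed_geom.isCompact
  -- `Δ_E ≃ₜ* N`
  let f : E.arith →ₜ* F.arith := ⟨φ.toMulEquiv.toMonoidHom, φ.continuous⟩
  let ψ : E.geom →ₜ* N :=
    ⟨f.toMonoidHom.subgroupMap E.geom,
      Continuous.subtype_mk ((map_continuous f).comp continuous_subtype_val) _⟩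
  have hψ : Function.Bijective ψ :=
    ⟨fun a b h => Subtype.ext (φ.injective (congrArg Subtype.val h)),
      f.toMonoidHom.subgroupMap_surjective E.geom⟩
  obtain ⟨e₁⟩ : Nonempty (E.geom ≃ₜ* N) :=
    ⟨{ toMulEquiv := MulEquiv.ofBijective ψ.toMonoidHom hψ
       continuous_toFun := ψ.continuous
       continuous_invFun :=
         (Continuous.homeoOfEquivCompactToT2 (f := Equiv.ofBijective ψ hψ) ψ.continuous).symm.continuous }⟩
  -- `N ≃ₜ* M` since `N ∩ Δ_F = 1` makes `aug_F|_N` injective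
  let g : N →ₜ* M :=
    ⟨F.aug.toMonoidHom.subgroupMap N,
      Continuous.subtype_mk ((map_continuous F.aug).comp continuous_subtype_val) _⟩
  have hg : Function.Bijective g := by
    refine ⟨fun a b h => ?_, F.aug.toMonoidHom.subgroupMap_surjective N⟩
    have hab : F.aug.toMonoidHom a = F.aug.toMonoidHom b := congrArg Subtype.val h
    have hk2 : (a : F.arith)⁻¹ * b ∈ F.geom := by
      rw [mem_geom, map_mul, map_inv]
      change (F.aug.toMonoidHom a)⁻¹ * F.aug.toMonoidHom b = 1
      rw [hab, inv_mul_cancel]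
    have hk : (a : F.arith)⁻¹ * b ∈ N ⊓ F.geom :=
      Subgroup.mem_inf.mpr ⟨N.mul_mem (N.inv_mem a.2) b.2, hk2⟩
    rw [hinf] at hk
    have hab' : (a : F.arith)⁻¹ * b = 1 := Subgroup.mem_bot.mp hk
    exact Subtype.ext (inv_mul_eq_one.mp hab')
  obtain ⟨e₂⟩ : Nonempty (N ≃ₜ* M) :=
    ⟨{ toMulEquiv := MulEquiv.ofBijective g.toMonoidHom hg
       continuous_toFun := g.continuous
       continuous_invFun :=
         (Continuous.homeoOfEquivCompactToT2 (f := Equiv.ofBijective g hg) g.continuous).symm.continuous }⟩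
  -- ranks of the open subgroup `M ⊆ G_F`
  obtain ⟨hMq, hMp⟩ := MLFBase.freeProlRank_of_isOpen_gal BF M hopen
  have h1 : freeProlRank E.geom ℓ = 1 := by
    rw [freeProlRank_eq_of_continuousMulEquiv e₁ ℓ, freeProlRank_eq_of_continuousMulEquiv e₂ ℓ]
    exact hMq ℓ hℓ
  have h2 : @freeProlRank E.geom _ _ BF.p BF.instPrime =
      ((Module.finrank ℚ_[BF.p] BF.K * (M.map BF.galIso.toMulEquiv.toMonoidHom).index + 1 : ℕ) : ℕ∞) := by
    rw [freeProlRank_eq_of_continuousMulEquiv e₁ BF.p, freeProlRank_eq_of_continuousMulEquiv e₂ BF.p]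
    exact hMp
  rw [hbal, h2] at h1
  -- `[k : ℚ_p] ≥ 1` and the index is `≥ 1`: the right-hand side is `≥ 2`
  have hidx : (M.map BF.galIso.toMulEquiv.toMonoidHom).index ≠ 0 := by
    rw [Subgroup.index_map_of_bijective
      (show Function.Bijective BF.galIso.toMulEquiv.toMonoidHom from BF.galIso.bijective) M]
    haveI : Finite (F.gal ⧸ M) := Subgroup.quotient_finite_of_isOpen M hopen
    exact (Subgroup.finiteIndex_of_finite_quotient (H := M)).index_ne_zero
  have hfr : 0 < Module.finrank ℚ_[BF.p] BF.K := Module.finrank_pos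
  have hnat : Module.finrank ℚ_[BF.p] BF.K * (M.map BF.galIso.toMulEquiv.toMonoidHom).index + 1 = 1 := by
    exact_mod_cast h1
  have hmul : Module.finrank ℚ_[BF.p] BF.K * (M.map BF.galIso.toMulEquiv.toMonoidHom).index = 0 := by omega
  rcases Nat.mul_eq_zero.mp hmul with h | h
  · exact absurd h hfr.ne'
  · exact hidx h

end FundamentalExtension

end Literature.AnabelianGeometry.AbsoluteAnabelian

end
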